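import Literature.MathematicalPhysics.QuantumFieldTheory.Balaban1983to89.B9Thm312WholeStepDirFrom3131

/-!
# `Balaban1983to89.B9Thm312WholeRightStepFrom3131` — [B9] Theorem 3.12 (pp. 421–423): THE RIGHT-FORM MEMBERS OF THE SECT.-D STEP SCHEMAS
# (`StepDir.tDd ∕ tDd1`: Δ′_πG₀∇\*_{U,μ}, (Δ′_π + Δ⁽²⁾_π)G₀∇\*_{U,μ} out of the input class; `Letters313IM.tDv`: (Δ′_π + Δ⁽²⁾_π)G₀D out of the
# scalar input class) PROVED from Theorem 3.3 for G₀ and the printed letters (3.131) ∕ (3.137) with the derivative moved to the RIGHT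
# (p. 421: *"applied … to an expression on the right"*) — whence the WHOLE schema `StepDir` from letters

T. Bałaban, *Propagators for lattice gauge theories in a background field*, Commun. Math. Phys. **99** (1985) 389–434
[`Balaban1985BackgroundPropagators`, "B9"]; [4] = T. Bałaban, *Propagators and renormalization transformations for lattice gauge
theories. II*, Commun. Math. Phys. **96** (1984) 223–250 [`Balaban1984PropagatorsII`].

statement-level skeleton of published theorems with citation tags; proofs where landed; nothing here is a claim about the Yang–Mills
mass gap

THE PRINTED LOCUS (held text `paper:balaban1985-cmp99-background-propagators`).  p. 421: *"One of the three derivatives there has to be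
applied either to an expression on the right, or on the left, of Δ′_π. For example one of the terms in ⟨A₁, Δ′_πA₂⟩ is … and we apply the
derivative D\* to A₁"*; p. 423: *"we have derivatives in the operator Δ′_π + Δ⁽²⁾_π which have to be applied either to the operator on the right,
or on the left"*; (3.130) p. 421 in print's RIGHT form G = G₀(I − Δ′_πG₀)⁻¹ = Σ G₀(Δ′_πG₀)ⁿ; (3.42)₃ p. 397, (3.44) p. 398 (*"|(∇_UG′(U)∇\*_Uλ)(x)| ≦
B′₀(ε)e^{−δ₀d(y,y′)}(‖λ‖_ε + |λ|) … (B′₀(ε) → ∞ if ε → 0)"*); p. 398: *"we may always replace ∇_U by ∇\*_U, and vice versa, in arbitrary place and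
combination"*; [4] (2.26) p. 228 (the gauge-mode derivative D and its adjoint D\*), Lemma 2.1 (2.60)–(2.61) p. 234.

THE POINT.  `B9Thm312WholeStepDirFrom3131` proved the eight LEFT-form families of `StepDir` from the left split Δ′_π = T_a + D·T_b
(`Letters3131`); its two RIGHT-form families `tDd ∕ tDd1` — T∘G₀∘∇\*_{U,μ} read from the input class `bHX ε` into 𝔠⁽¹⁾ — and row 21's twin
`Letters313IM.tDv` — (Δ′_π + Δ⁽²⁾_π)∘G₀∘D from `bHW ε` — need the derivative on the OTHER side: with the RIGHT split T = T_a′ + T_b′·D\* (D\* =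
`𝔬.Dvstar U`, the adjoint gauge-mode derivative, moved onto the propagator to its right), T∘G₀F = T_a′(G₀F) + T_b′(D\*G₀F) for F ∈ {∇\*_{U,μ}, D}:
the first summand is Theorem 3.3's (3.42)₃-type member G₀F (transferred by one power of the scale, p. 398) composed with T_a′, the second the
(3.44)-type member D\*G₀F out of the input class composed with T_b′ — ONE composition each.  THIS FILE types that:
* §1 `Letters3131R 𝔬 Ta Ta₂ Tb Tb₂ R₀ H₀ hlen t δT U` — the (3.131) ∕ (3.137) letters WITH THE DERIVATIVE MOVED RIGHT (printed shape, nothing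
  asserted): Δ′_π = T_a′ + T_b′·D\*, Δ⁽²⁾_π = T_a₂′ + T_b₂′·D\*, T_a′ : 𝔠⁽²⁾ → 𝔠⁽⁰⁾ and T_b′ : 𝔠_W⁽⁰⁾ → 𝔠⁽¹⁾ (one order below Δ′_π) with t·e^{−δ_T d};
  `Thm33G0DivR 𝔬 Dds R₀ H₀ hlen bHX bHW BiD BdD δ₀ δ₃ U` — two (3.44)-TYPE MEMBERS OF G₀ WITH D\* ON THE LEFT: D\*G₀∇\*_{U,μ} : `bHX ε` → 𝔠_W⁽⁰⁾
  (B_iD(ε)) and D\*G₀D : `bHW ε` → 𝔠_W⁽⁰⁾ (B_dD(ε)) (printed type by p. 398's *"arbitrary place and combination"*; ε-INDEXED constants).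
* §2 ★ `rightStep_of_splitR` — GENERIC: T∘G₀F from an input class `bin` into 𝔠⁽¹⁾ with (a·L₀ + a_D)·t·c·e^{−(ρ−αδ)d}, from G₀F : `bin` → 𝔠^{(−1)}
  (a·e^{−ρ_a d}), D\*G₀F : `bin` → 𝔠_W⁽⁰⁾ (a_D·e^{−ρ_D d}) and the right-split letters (compositions at the margin σ taken on the INNER factor,
  `hasMaj_comp_exp_mirror`; the transfer of T_a′ by `Facts347`).
* §3 ★ `tDd_of_letters3131R` (per μ and ε: both right-form fields, constants (B₀·L₀ + B_iD(ε))·t·c resp. twice that, from `Thm33G0DirR.e2d`, the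
  domination `domX ∕ locX` of the input norms, `Thm33G0DivR.h44Ds`, `Letters3131R`), ★ `tDv_of_letters3131R` (per ε: row 21's
  `Letters313IM.tDv` shape with constant 2(B₃·L₀·L₀ + B_dD(ε))·t·c at rate ρ − 2αδ, from the G₀D entry `Letters313.gD2`'s shape (transferred by one
  power), `domW ∕ locW`, `Thm33G0DivR.h44DsDv`, `Letters3131R`).
* §4 ★★ `stepDir_of_letters3131LR` — THE WHOLE `StepDir` from letters: `B9Thm312WholeStepDirFrom3131.stepDir_of_letters3131` with its two
  right-form hypotheses supplied by §3 under ONE MORE β∕ε-UNIFORM domination hypothesis `hθH4 : ∀ ε > 0, 2(B₀L₀ + B_iD ε)tc ≦ θ_H` (LOCATED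
  REMARK U3: the registered schema's single θ_H is uniform in the input exponent ε while print's B′₀(ε) → ∞ as ε → 0; the ε-indexed content
  is §3).

HONEST SCOPE.  Kernel-checked bookkeeping; `Letters3131R`, `Thm33G0DivR` are HYPOTHESIS SCHEMAS of printed type (their derivation — (3.120),
(3.135)–(3.137), Theorems 3.1 ∕ 3.3, (3.49) — is the located gap G-B9-16; LOCATED REMARK U1 of the sibling files applies verbatim to the right split:
the leading D of the left factor I − DRG′D\* of (3.135) is then read un-sandwiched).  COUNT-NEUTRAL; N06 is NOT discharged; one finite lattice at a
time; nothing continuum, nothing about the mass gap.  Cell `pub-ymgap` (HUMAN RULING D-0062), Track A node N06 [B9], N06-ASSIGNMENT v1 rows 20–21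
(bundle F7), seat `pub-ymgap-dag-n06-l` (g12), 2026-08-27.
-/

namespace Literature.MathematicalPhysics.QuantumFieldTheory.Balaban1983to89.B9Thm312WholeRightStepFrom3131

open Literature.MathematicalPhysics.QuantumFieldTheory.Balaban1983to89
open Finset B6RandomWalk B6RandomWalkHom B9Thm34Ext B11SectG B9SectDSup B9Thm312Whole B9Thm312WholeLeaf B9Thm312WholeClasses
open B9RWSums343Holder B9RWSums343to347Whole B9RWSums346Schur B9Thm312WholeDir B9Thm313WholeHolder B9Thm313WholeDir
open B9Thm312WholeStepFrom3131 B9Thm312WholeLeftStepFrom3131 B9Thm312WholeStepDirFrom3131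

noncomputable section

variable {g : B9.Geometry} {B : B9.Backgrounds} {X Y Z W PX PY P : Type}
variable [Fintype X] [Fintype Y] [Fintype Z] [Fintype W] [Fintype PX] [Fintype PY] [Fintype P] [Fintype g.Site]
variable {R₀ : ℝ} {H₀ : Prop}

/-! ## §1 The right-split letters of Δ′_π, Δ⁽²⁾_π and two (3.44)-type members of G₀ with D\* (printed type; nothing asserted) -/

/-- **THE LETTERS (3.131) ∕ (3.137) WITH THE DERIVATIVE MOVED TO THE RIGHT** (p. 421: *"One of the three derivatives there has to be applied
either to an expression on the right, or on the left, of Δ′_π"*; (3.135): the right factor I − DG′RD\* of Δ⁽²⁾_π ends with D\*): at the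
configuration U, Δ′_π = T_a′ + T_b′·D\* (`splitR`) and Δ⁽²⁾_π = T_a₂′ + T_b₂′·D\* (`splitR₂`), D\* = `𝔬.Dvstar U` the adjoint gauge-mode
derivative of DRD\* ([4] (2.26)), where T_a′, T_a₂′ map the state norm 𝔠⁽²⁾ into 𝔠⁽⁰⁾ (as in `Letters3131`) and T_b′, T_b₂′ map the sup class
𝔠_W⁽⁰⁾ of scalar site fields into 𝔠⁽¹⁾ (one order below Δ′_π: the derivative D\* has been taken out), all with the small local majorant
t·e^{−δ_T d(y,y′)} (t = O(1)·Mα₀ in print).  A HYPOTHESIS SCHEMA over FREE letters; nothing constructed or asserted.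
[cite: Balaban1985BackgroundPropagators, (3.130)–(3.131) pp.421–422 + (3.135)–(3.137) pp.422–423 + p.398 (remark after (3.47)); Balaban1984PropagatorsII, (2.26) p.228] -/
structure Letters3131R (𝔬 : Ops g B X Y Z W) (Ta Ta₂ : B.Cfg → Module.End ℝ (X → ℝ))
    (Tb Tb₂ : B.Cfg → (W → ℝ) →ₗ[ℝ] (X → ℝ)) (R₀ : ℝ) (H₀ : Prop) (hlen : ∀ y : g.Site, 0 ≤ g.len y) (t δT : ℝ)
    (U : B.Cfg) : Prop where
  splitR : 𝔬.Tpi U = Ta U + Tb U ∘ₗ 𝔬.Dvstar U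
  splitR₂ : 𝔬.T2 U = Ta₂ U + Tb₂ U ∘ₗ 𝔬.Dvstar U
  ta : HasMaj (cNorm R₀ H₀ 𝔬.blk hlen 2) (cNorm R₀ H₀ 𝔬.blk hlen 0) (Ta U) (fun a b => t * Real.exp (-(δT * g.dist a b)))
  ta₂ : HasMaj (cNorm R₀ H₀ 𝔬.blk hlen 2) (cNorm R₀ H₀ 𝔬.blk hlen 0) (Ta₂ U) (fun a b => t * Real.exp (-(δT * g.dist a b)))
  tb : HasMaj (cNormR R₀ H₀ 𝔬.blkW hlen 0) (cNormR R₀ H₀ 𝔬.blk hlen 1) (Tb U) (fun a b => t * Real.exp (-(δT * g.dist a b)))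
  tb₂ : HasMaj (cNormR R₀ H₀ 𝔬.blkW hlen 0) (cNormR R₀ H₀ 𝔬.blk hlen 1) (Tb₂ U) (fun a b => t * Real.exp (-(δT * g.dist a b)))

/-- **TWO (3.44)-TYPE MEMBERS OF THEOREM 3.3 FOR G₀ WITH THE ADJOINT GAUGE-MODE DERIVATIVE ON THE LEFT** (p. 398: *"we may always replace ∇_U by
∇\*_U, and vice versa, in arbitrary place and combination"*; [4] (2.26)): `h44Ds μ ε` — D\*G₀∇\*_{U,μ} read from the input Hölder class `bHX ε` of
the G-lattice into the sup class 𝔠_W⁽⁰⁾ of scalar site fields, constant B_iD(ε)·e^{−δ₀d}; `h44DsDv ε` — D\*G₀D read from the scalar input class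
`bHW ε` into 𝔠_W⁽⁰⁾, constant B_dD(ε)·e^{−δ₃d}.  The constants are ε-INDEXED (print: B′₀(ε) → ∞ as ε → 0).  A HYPOTHESIS SCHEMA (at the instance:
Theorem 3.3 ∕ 3.10 statements about G₀ = G(U)); nothing asserted.
[cite: Balaban1985BackgroundPropagators, Thm 3.3 p.399 + (3.44) p.398 + p.398 (remarks after (3.47)) + (3.39) p.397; Balaban1984PropagatorsII, (2.26) p.228] -/
structure Thm33G0DivR (𝔬 : Ops g B X Y Z W) (Dds : B.Cfg → P → Module.End ℝ (X → ℝ)) (R₀ : ℝ) (H₀ : Prop)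
    (hlen : ∀ y : g.Site, 0 ≤ g.len y) (bHX : ℝ → BlockNorm (toB6 g R₀ H₀) (X → ℝ)) (bHW : ℝ → BlockNorm (toB6 g R₀ H₀) (W → ℝ))
    (BiD BdD : ℝ → ℝ) (δ₀ δ₃ : ℝ) (U : B.Cfg) : Prop where
  h44Ds : ∀ (μ : P) (ε : ℝ), 0 < ε → HasMaj (bHX ε) (cNormR R₀ H₀ 𝔬.blkW hlen 0) (𝔬.Dvstar U ∘ₗ (𝔬.G0 U ∘ₗ Dds U μ))
    (fun a b => BiD ε * Real.exp (-(δ₀ * g.dist a b)))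
  h44DsDv : ∀ ε : ℝ, 0 < ε → HasMaj (bHW ε) (cNormR R₀ H₀ 𝔬.blkW hlen 0) (𝔬.Dvstar U ∘ₗ (𝔬.G0 U ∘ₗ 𝔬.Dv U))
    (fun a b => BdD ε * Real.exp (-(δ₃ * g.dist a b)))

/-! ## §2 The generic right-form member T∘G₀F -/

omit [Fintype Y] [Fintype Z] [Fintype W] [Fintype PX] [Fintype PY] [Fintype P] [Fintype X] [Fintype g.Site] in
/-- Kernel monotonicity: C·e^{−rd} ≦ θ·e^{−δ_K d} for 0 ≦ C ≦ θ, δ_K ≦ r, d ≧ 0. [folklore] -/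
private theorem kernel_le₃ {C θ r δK d : ℝ} (hC : 0 ≤ C) (hCθ : C ≤ θ) (hδK : δK ≤ r) (hd : 0 ≤ d) :
    C * Real.exp (-(r * d)) ≤ θ * Real.exp (-(δK * d)) :=
  calc C * Real.exp (-(r * d)) ≤ C * Real.exp (-(δK * d)) :=
      mul_le_mul_of_nonneg_left (Real.exp_le_exp.mpr (neg_le_neg (mul_le_mul_of_nonneg_right hδK hd))) hC
    _ ≤ θ * Real.exp (-(δK * d)) := mul_le_mul_of_nonneg_right hCθ (Real.exp_nonneg _)

omit [Fintype Y] [Fintype Z] [Fintype PX] [Fintype PY] [Fintype P] in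
/-- ★ **THE GENERIC RIGHT-FORM MEMBER T∘G₀F FOR A RIGHT-SPLIT PERTURBATION T = T_a′ + T_b′·D\***: if G₀F maps an input class `bin` into 𝔠^{(−1)}
with a·e^{−ρ_a d} (a (3.42)₃-type member of G₀) and D\*G₀F maps `bin` into 𝔠_W⁽⁰⁾ with a_D·e^{−ρ_D d} (a (3.44)-type member), while T_a′ : 𝔠⁽²⁾ → 𝔠⁽⁰⁾
and T_b′ : 𝔠_W⁽⁰⁾ → 𝔠⁽¹⁾ have the small majorants t·e^{−δ_T d}, then T∘(G₀F) = T_a′(G₀F) + T_b′(D\*G₀F) maps `bin` into 𝔠⁽¹⁾ with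
(a·L₀ + a_D)·t·c·e^{−(ρ−αδ)d} for every ρ with αδ ≦ ρ ≦ δ_T, ρ − αδ + σ ≦ ρ_a and ρ − αδ + σ ≦ ρ_D — T_a′ is first transferred to 𝔠^{(−1)} → 𝔠⁽¹⁾
(p. 398, cost L₀·e^{αδd}, `hasMaj_transfer_one`), then [4] (2.54) with Lemma 2.1 (2.61) at the margin σ on the inner factor
(`hasMaj_comp_exp_mirror`, d symmetric).
[cite: Balaban1985BackgroundPropagators, (3.130)–(3.131) pp.421–422 + (3.137)–(3.138) p.423 + (3.42)–(3.44) pp.397–398 + p.398 (remarks after (3.47)); Balaban1984PropagatorsII, (2.52)–(2.56) pp.232–233 + Lemma 2.1 (2.60)–(2.61) p.234] -/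
theorem rightStep_of_splitR (hG : GeoOK g) {d : ℕ} {δ α L₀ : ℝ} (hF : Facts347 g R₀ H₀ d δ α L₀)
    {F₀ : Type} [AddCommGroup F₀] [Module ℝ F₀] {bin : BlockNorm (toB6 g R₀ H₀) F₀}
    {blk : X → g.Site} {blkW : W → g.Site} {T Ta : Module.End ℝ (X → ℝ)} {Tb : (W → ℝ) →ₗ[ℝ] (X → ℝ)}
    {Ds : (X → ℝ) →ₗ[ℝ] (W → ℝ)} {GF : F₀ →ₗ[ℝ] (X → ℝ)}
    {a aD t ρa ρD δT ρ σ c : ℝ} (hrow : RowSum (toB6 g R₀ H₀) σ c)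
    (ha : 0 ≤ a) (haD : 0 ≤ aD) (ht : 0 ≤ t) (hαρ : α * δ ≤ ρ) (hαδ : 0 ≤ α * δ) (hρT : ρ ≤ δT)
    (hρa : ρ - α * δ + σ ≤ ρa) (hρD : ρ - α * δ + σ ≤ ρD) (hsplit : T = Ta + Tb ∘ₗ Ds)
    (hGF : HasMaj bin (cNormR R₀ H₀ blk hG.lenle (-1)) GF (fun a' b => a * Real.exp (-(ρa * g.dist a' b))))
    (hDGF : HasMaj bin (cNormR R₀ H₀ blkW hG.lenle 0) (Ds ∘ₗ GF) (fun a' b => aD * Real.exp (-(ρD * g.dist a' b))))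
    (hta : HasMaj (cNorm R₀ H₀ blk hG.lenle 2) (cNorm R₀ H₀ blk hG.lenle 0) Ta (fun a' b => t * Real.exp (-(δT * g.dist a' b))))
    (htb : HasMaj (cNormR R₀ H₀ blkW hG.lenle 0) (cNormR R₀ H₀ blk hG.lenle 1) Tb
      (fun a' b => t * Real.exp (-(δT * g.dist a' b)))) :
    HasMaj bin (cNormR R₀ H₀ blk hG.lenle 1) (T ∘ₗ GF)
      (fun a' b => (a * L₀ + aD) * t * c * Real.exp (-((ρ - α * δ) * g.dist a' b))) := by
  have htri : Triangle254 (toB6 g R₀ H₀) := fun a b c => hG.tri a b c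
  have hsym : DistSymm (toB6 g R₀ H₀) := fun a b => hG.symm a b
  have hL₀ : 0 ≤ L₀ := le_trans (le_trans zero_le_one hF.one_le_L) hF.L_le
  have hρ' : 0 ≤ ρ - α * δ := by linarith
  -- T_a′ : 𝔠⁽²⁾ → 𝔠⁽⁰⁾ as 𝔠^{(−2)} → 𝔠^{(0)}, transferred to 𝔠^{(−1)} → 𝔠^{(1)}
  have hta' : HasMaj (cNormR R₀ H₀ blk hG.lenle (-2)) (cNormR R₀ H₀ blk hG.lenle 0) Ta
      (fun a' b => t * Real.exp (-(δT * g.dist a' b))) := by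
    have h := hasMaj_toR hG hta
    simp only [Nat.cast_zero, neg_zero, Nat.cast_ofNat] at h
    exact h
  have hta'' := hasMaj_transfer_one hG hF ht hta'
  have e1 : (-2 : ℝ) + 1 = -1 := by norm_num
  have e2 : (0 : ℝ) + 1 = 1 := by norm_num
  rw [e1, e2] at hta''
  -- first summand: T_a′(G₀F), margin on the inner factor
  have hρT' : ρ - α * δ ≤ δT - α * δ := by linarith
  have h1 := hasMaj_comp_exp_mirror hsym htri hG.dnn hrow (mul_nonneg ht hL₀) ha hρ' hρT' hρa hta'' hGF
  simp only [cNormR_κ, one_mul] at h1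
  -- second summand: T_b′(D\*G₀F)
  have hρT'' : ρ - α * δ ≤ δT := by linarith
  have h2 := hasMaj_comp_exp_mirror hsym htri hG.dnn hrow ht haD hρ' hρT'' hρD htb hDGF
  simp only [cNormR_κ, one_mul] at h2
  refine ((h1.add h2).congr fun μ => ?_).mono fun a' b => le_of_eq ?_
  · rw [hsplit]
    simp only [LinearMap.add_apply, LinearMap.comp_apply]
  · simp only [toB6_dist]
    ring

/-! ## §3 The right-form fields of `StepDir` and row 21's `Letters313IM.tDv` -/

omit [Fintype Y] [Fintype Z] [Fintype PX] [Fintype PY] [Fintype P] in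
/-- ★ **THE RIGHT-FORM FIELDS `tDd μ ε`, `tDd1 μ ε` OF `StepDir`, ε-INDEXED** — Δ′_πG₀∇\*_{U,μ} and (Δ′_π + Δ⁽²⁾_π)G₀∇\*_{U,μ} map the input class
`bHX ε` into 𝔠⁽¹⁾ with (B₀·L₀ + B_iD(ε))·t·c·e^{−(ρ−αδ)d} resp. 2(B₀·L₀ + B_iD(ε))·t·c·e^{−(ρ−αδ)d}, from: (3.42)₃ for the component G₀∇\*_{U,μ}
(`Thm33G0DirR.e2d`'s shape), the domination of the block sup by the input norm (`Letters313IM.domX ∕ locX`'s shape), the (3.44)-type member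
D\*G₀∇\*_{U,μ} (`Thm33G0DivR.h44Ds`) and the right-split letters `Letters3131R`; αδ ≦ ρ ≦ δ_T, ρ + σ ≦ δ₀ (so that ρ − αδ + σ ≦ δ₀).
[cite: Balaban1985BackgroundPropagators, Thm 3.12 p.423 + (3.130)–(3.131) pp.421–422 + (3.137)–(3.138) p.423 + (3.42)–(3.44) pp.397–398 + p.398; Balaban1984PropagatorsII, (2.54) p.233 + Lemma 2.1 (2.60)–(2.61) p.234] -/
theorem tDd_of_letters3131R (hG : GeoOK g) {d : ℕ} {δ α L₀ : ℝ} (hF : Facts347 g R₀ H₀ d δ α L₀) {𝔬 : Ops g B X Y Z W}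
    {Dds : B.Cfg → P → Module.End ℝ (X → ℝ)} {bHX : ℝ → BlockNorm (toB6 g R₀ H₀) (X → ℝ)}
    {bHW : ℝ → BlockNorm (toB6 g R₀ H₀) (W → ℝ)} {Ta Ta₂ : B.Cfg → Module.End ℝ (X → ℝ)}
    {Tb Tb₂ : B.Cfg → (W → ℝ) →ₗ[ℝ] (X → ℝ)} {U : B.Cfg} {B₀ t δ₀ δ₃ δT ρ σ c : ℝ} {BiD BdD : ℝ → ℝ}
    (hrow : RowSum (toB6 g R₀ H₀) σ c) (hB₀ : 0 ≤ B₀) (ht : 0 ≤ t) (hBiD : ∀ ε : ℝ, 0 < ε → 0 ≤ BiD ε)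
    (hαρ : α * δ ≤ ρ) (hαδ : 0 ≤ α * δ) (hρT : ρ ≤ δT) (hρ₀ : ρ + σ ≤ δ₀)
    (he2d : ∀ μ : P, HasMajorantHom (g := toB6 g R₀ H₀) 𝔬.blk 𝔬.blk (𝔬.G0 U ∘ₗ Dds U μ)
      (fun (a b : g.Site) => B₀ * g.len a * Real.exp (-(δ₀ * g.dist a b))))
    (hdomX : ∀ ε : ℝ, 0 < ε → ∀ (y : g.Site) (μ : X → ℝ), (BlockNorm.ofBlocks (toB6 g R₀ H₀) 𝔬.blk).loc y μ ≤ (bHX ε).loc y μ)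
    (hlocX : ∀ ε : ℝ, 0 < ε → ∀ (y : g.Site) (μ : X → ℝ), (bHX ε).IsLoc y μ → (BlockNorm.ofBlocks (toB6 g R₀ H₀) 𝔬.blk).IsLoc y μ)
    (hdiv : Thm33G0DivR 𝔬 Dds R₀ H₀ hG.lenle bHX bHW BiD BdD δ₀ δ₃ U) (hR : Letters3131R 𝔬 Ta Ta₂ Tb Tb₂ R₀ H₀ hG.lenle t δT U)
    (μ : P) (ε : ℝ) (hε : 0 < ε) :
    HasMaj (bHX ε) (cNormR R₀ H₀ 𝔬.blk hG.lenle 1) (𝔬.Tpi U ∘ₗ (𝔬.G0 U ∘ₗ Dds U μ))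
        (fun a b => (B₀ * L₀ + BiD ε) * t * c * Real.exp (-((ρ - α * δ) * g.dist a b))) ∧
      HasMaj (bHX ε) (cNormR R₀ H₀ 𝔬.blk hG.lenle 1) ((𝔬.Tpi U + 𝔬.T2 U) ∘ₗ (𝔬.G0 U ∘ₗ Dds U μ))
        (fun a b => 2 * ((B₀ * L₀ + BiD ε) * t * c) * Real.exp (-((ρ - α * δ) * g.dist a b))) := by
  -- G₀∇\*_μ : 𝔠⁽⁰⁾ → 𝔠^{(−1)}, then out of the dominating input class
  have hG1 : HasMaj (cNormR R₀ H₀ 𝔬.blk hG.lenle 0) (cNormR R₀ H₀ 𝔬.blk hG.lenle (-1)) (𝔬.G0 U ∘ₗ Dds U μ)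
      (fun a b => B₀ * Real.exp (-(δ₀ * g.dist a b))) :=
    hasMaj_cNormR_of_hasMajorantHom hG (C := fun a b => B₀ * Real.exp (-(δ₀ * g.dist a b)))
      (fun a b => mul_nonneg hB₀ (Real.exp_nonneg _)) 1 0
      (hasMajorantHom_mono (g := toB6 g R₀ H₀) 𝔬.blk 𝔬.blk (he2d μ) fun a b =>
        le_of_eq (by simp only [Real.rpow_zero, Real.rpow_one, mul_one]; ring))
  have hGF : HasMaj (bHX ε) (cNormR R₀ H₀ 𝔬.blk hG.lenle (-1)) (𝔬.G0 U ∘ₗ Dds U μ)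
      (fun a b => B₀ * Real.exp (-(δ₀ * g.dist a b))) :=
    B9Thm313WholeInput.hasMaj_of_dom (hdomX ε hε) (hlocX ε hε) (fun a b => mul_nonneg hB₀ (Real.exp_nonneg _))
      (hasMaj_of_in_zero hG1)
  have hρa : ρ - α * δ + σ ≤ δ₀ := by linarith
  have hA := rightStep_of_splitR hG hF hrow hB₀ (hBiD ε hε) ht hαρ hαδ hρT hρa hρa hR.splitR hGF (hdiv.h44Ds μ ε hε) hR.ta hR.tb
  have hB := rightStep_of_splitR hG hF hrow hB₀ (hBiD ε hε) ht hαρ hαδ hρT hρa hρa hR.splitR₂ hGF (hdiv.h44Ds μ ε hε) hR.ta₂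
    hR.tb₂
  refine ⟨hA, ((hA.add hB).congr fun ν => ?_).mono fun a b => le_of_eq ?_⟩
  · simp only [LinearMap.add_apply, LinearMap.comp_apply]
  · ring

omit [Fintype Y] [Fintype Z] [Fintype PX] [Fintype PY] [Fintype P] in
/-- ★ **ROW 21's RIGHT-FORM LETTER `Letters313IM.tDv ε` (and its Δ′_π twin), ε-INDEXED** — Δ′_πG₀D and (Δ′_π + Δ⁽²⁾_π)G₀D map the scalar input class
`bHW ε` into 𝔠⁽¹⁾ with (B₃·L₀·L₀ + B_dD(ε))·t·c·e^{−(ρ−2αδ)d} resp. twice that, from: the G₀D entry of Theorem 3.3's type (`Letters313.gD2`'s shape,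
G₀D : 𝔠_W⁽¹⁾ → 𝔠⁽²⁾, B₃e^{−δ₃d}; transferred by one power to 𝔠_W⁽⁰⁾ → 𝔠^{(−1)}), the domination of the scalar block sup by the scalar input norm
(`domW ∕ locW`), the (3.44)-type member D\*G₀D (`Thm33G0DivR.h44DsDv`) and `Letters3131R`; 2αδ ≦ ρ ≦ δ_T, ρ + σ ≦ δ₃.
[cite: Balaban1985BackgroundPropagators, Thm 3.13 p.426 + Thm 3.12 p.423 + (3.130)–(3.131) pp.421–422 + (3.137)–(3.138) p.423 + (3.42)–(3.44) pp.397–398 + p.398; Balaban1984PropagatorsII, (2.26) p.228 + (2.54) p.233 + Lemma 2.1 (2.60)–(2.61) p.234] -/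
theorem tDv_of_letters3131R (hG : GeoOK g) {d : ℕ} {δ α L₀ : ℝ} (hF : Facts347 g R₀ H₀ d δ α L₀) {𝔬 : Ops g B X Y Z W}
    {Dds : B.Cfg → P → Module.End ℝ (X → ℝ)} {bHX : ℝ → BlockNorm (toB6 g R₀ H₀) (X → ℝ)}
    {bHW : ℝ → BlockNorm (toB6 g R₀ H₀) (W → ℝ)} {Ta Ta₂ : B.Cfg → Module.End ℝ (X → ℝ)}
    {Tb Tb₂ : B.Cfg → (W → ℝ) →ₗ[ℝ] (X → ℝ)} {U : B.Cfg} {B₃ t δ₀ δ₃ δT ρ σ c : ℝ} {BiD BdD : ℝ → ℝ}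
    (hrow : RowSum (toB6 g R₀ H₀) σ c) (hB₃ : 0 ≤ B₃) (ht : 0 ≤ t) (hBdD : ∀ ε : ℝ, 0 < ε → 0 ≤ BdD ε)
    (hαρ : 2 * (α * δ) ≤ ρ) (hαδ : 0 ≤ α * δ) (hρT : ρ ≤ δT) (hρ₃ : ρ + σ ≤ δ₃)
    (hgD : HasMaj (cNorm R₀ H₀ 𝔬.blkW hG.lenle 1) (cNorm R₀ H₀ 𝔬.blk hG.lenle 2) (𝔬.G0 U ∘ₗ 𝔬.Dv U)
      (fun a b => B₃ * Real.exp (-(δ₃ * g.dist a b))))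
    (hdomW : ∀ ε : ℝ, 0 < ε → ∀ (y : g.Site) (μ : W → ℝ), (BlockNorm.ofBlocks (toB6 g R₀ H₀) 𝔬.blkW).loc y μ ≤ (bHW ε).loc y μ)
    (hlocW : ∀ ε : ℝ, 0 < ε → ∀ (y : g.Site) (μ : W → ℝ), (bHW ε).IsLoc y μ → (BlockNorm.ofBlocks (toB6 g R₀ H₀) 𝔬.blkW).IsLoc y μ)
    (hdiv : Thm33G0DivR 𝔬 Dds R₀ H₀ hG.lenle bHX bHW BiD BdD δ₀ δ₃ U) (hR : Letters3131R 𝔬 Ta Ta₂ Tb Tb₂ R₀ H₀ hG.lenle t δT U)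
    (ε : ℝ) (hε : 0 < ε) :
    HasMaj (bHW ε) (cNormR R₀ H₀ 𝔬.blk hG.lenle 1) (𝔬.Tpi U ∘ₗ (𝔬.G0 U ∘ₗ 𝔬.Dv U))
        (fun a b => (B₃ * L₀ * L₀ + BdD ε) * t * c * Real.exp (-((ρ - α * δ - α * δ) * g.dist a b))) ∧
      HasMaj (bHW ε) (cNormR R₀ H₀ 𝔬.blk hG.lenle 1) ((𝔬.Tpi U + 𝔬.T2 U) ∘ₗ (𝔬.G0 U ∘ₗ 𝔬.Dv U))
        (fun a b => 2 * ((B₃ * L₀ * L₀ + BdD ε) * t * c) * Real.exp (-((ρ - α * δ - α * δ) * g.dist a b))) := by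
  have hL₀ : 0 ≤ L₀ := le_trans (le_trans zero_le_one hF.one_le_L) hF.L_le
  -- G₀D : 𝔠_W⁽¹⁾ → 𝔠⁽²⁾ as 𝔠_W^{(−1)} → 𝔠^{(−2)}, transferred to 𝔠_W⁽⁰⁾ → 𝔠^{(−1)}, then out of the dominating scalar input class
  have hgD' : HasMaj (cNormR R₀ H₀ 𝔬.blkW hG.lenle (-1)) (cNormR R₀ H₀ 𝔬.blk hG.lenle (-2)) (𝔬.G0 U ∘ₗ 𝔬.Dv U)
      (fun a b => B₃ * Real.exp (-(δ₃ * g.dist a b))) := by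
    have h := hasMaj_toR hG hgD
    simp only [Nat.cast_one, Nat.cast_ofNat] at h
    exact h
  have hgD'' := hasMaj_transfer_one hG hF hB₃ hgD'
  have e1 : (-1 : ℝ) + 1 = 0 := by norm_num
  have e2 : (-2 : ℝ) + 1 = -1 := by norm_num
  rw [e1, e2] at hgD''
  have hGF : HasMaj (bHW ε) (cNormR R₀ H₀ 𝔬.blk hG.lenle (-1)) (𝔬.G0 U ∘ₗ 𝔬.Dv U)
      (fun a b => B₃ * L₀ * Real.exp (-((δ₃ - α * δ) * g.dist a b))) :=
    B9Thm313WholeInput.hasMaj_of_dom (hdomW ε hε) (hlocW ε hε) (fun a b => mul_nonneg (mul_nonneg hB₃ hL₀) (Real.exp_nonneg _))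
      (hasMaj_of_in_zero hgD'')
  have hαρ' : α * δ ≤ ρ - α * δ := by linarith
  have hρT' : ρ - α * δ ≤ δT := by linarith
  have hρa : ρ - α * δ - α * δ + σ ≤ δ₃ - α * δ := by linarith
  have hρD : ρ - α * δ - α * δ + σ ≤ δ₃ := by linarith
  have hA := rightStep_of_splitR hG hF hrow (mul_nonneg hB₃ hL₀) (hBdD ε hε) ht hαρ' hαδ hρT' hρa hρD hR.splitR hGF
    (hdiv.h44DsDv ε hε) hR.ta hR.tb
  have hB := rightStep_of_splitR hG hF hrow (mul_nonneg hB₃ hL₀) (hBdD ε hε) ht hαρ' hαδ hρT' hρa hρD hR.splitR₂ hGF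
    (hdiv.h44DsDv ε hε) hR.ta₂ hR.tb₂
  refine ⟨hA.mono fun a b => le_of_eq (by ring), ((hA.add hB).congr fun ν => ?_).mono fun a b => le_of_eq ?_⟩
  · simp only [LinearMap.add_apply, LinearMap.comp_apply]
  · ring

omit [Fintype Y] [Fintype Z] [Fintype PX] [Fintype PY] [Fintype P] in
/-- **ROW 21's `Letters313IM.tDv` FIELD VERBATIM (θ_v·e^{−δ_K d}, ONE θ_v FOR ALL ε)** from `tDv_of_letters3131R` under the ε-UNIFORM domination
θ_v ≧ 2(B₃·L₀·L₀ + B_dD(ε))·t·c for all ε > 0 (LOCATED REMARK U3: the registered field's single θ_v is ε-uniform while print's B′₀(ε) → ∞ as ε → 0; the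
ε-indexed content is `tDv_of_letters3131R`) and δ_K + 2αδ ≦ ρ.
[cite: Balaban1985BackgroundPropagators, Thm 3.13 p.426 + Thm 3.12 p.423 + (3.130)–(3.131) pp.421–422 + (3.137)–(3.138) p.423 + (3.44) p.398] -/
theorem tDv_uniform_of_letters3131R (hG : GeoOK g) {d : ℕ} {δ α L₀ : ℝ} (hF : Facts347 g R₀ H₀ d δ α L₀) {𝔬 : Ops g B X Y Z W}
    {Dds : B.Cfg → P → Module.End ℝ (X → ℝ)} {bHX : ℝ → BlockNorm (toB6 g R₀ H₀) (X → ℝ)}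
    {bHW : ℝ → BlockNorm (toB6 g R₀ H₀) (W → ℝ)} {Ta Ta₂ : B.Cfg → Module.End ℝ (X → ℝ)}
    {Tb Tb₂ : B.Cfg → (W → ℝ) →ₗ[ℝ] (X → ℝ)} {U : B.Cfg} {B₃ t δ₀ δ₃ δT ρ σ c θv δK : ℝ} {BiD BdD : ℝ → ℝ}
    (hrow : RowSum (toB6 g R₀ H₀) σ c) (hc : 0 ≤ c) (hB₃ : 0 ≤ B₃) (ht : 0 ≤ t) (hBdD : ∀ ε : ℝ, 0 < ε → 0 ≤ BdD ε)
    (hαδ : 0 ≤ α * δ) (hδK0 : 0 ≤ δK) (hδK : δK + 2 * (α * δ) ≤ ρ) (hρT : ρ ≤ δT) (hρ₃ : ρ + σ ≤ δ₃)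
    (hθv : ∀ ε : ℝ, 0 < ε → 2 * ((B₃ * L₀ * L₀ + BdD ε) * t * c) ≤ θv)
    (hgD : HasMaj (cNorm R₀ H₀ 𝔬.blkW hG.lenle 1) (cNorm R₀ H₀ 𝔬.blk hG.lenle 2) (𝔬.G0 U ∘ₗ 𝔬.Dv U)
      (fun a b => B₃ * Real.exp (-(δ₃ * g.dist a b))))
    (hdomW : ∀ ε : ℝ, 0 < ε → ∀ (y : g.Site) (μ : W → ℝ), (BlockNorm.ofBlocks (toB6 g R₀ H₀) 𝔬.blkW).loc y μ ≤ (bHW ε).loc y μ)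
    (hlocW : ∀ ε : ℝ, 0 < ε → ∀ (y : g.Site) (μ : W → ℝ), (bHW ε).IsLoc y μ → (BlockNorm.ofBlocks (toB6 g R₀ H₀) 𝔬.blkW).IsLoc y μ)
    (hdiv : Thm33G0DivR 𝔬 Dds R₀ H₀ hG.lenle bHX bHW BiD BdD δ₀ δ₃ U) (hR : Letters3131R 𝔬 Ta Ta₂ Tb Tb₂ R₀ H₀ hG.lenle t δT U)
    (ε : ℝ) (hε : 0 < ε) :
    HasMaj (bHW ε) (cNormR R₀ H₀ 𝔬.blk hG.lenle 1) ((𝔬.Tpi U + 𝔬.T2 U) ∘ₗ (𝔬.G0 U ∘ₗ 𝔬.Dv U))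
      (fun a b => θv * Real.exp (-(δK * g.dist a b))) := by
  have hL₀ : 0 ≤ L₀ := le_trans (le_trans zero_le_one hF.one_le_L) hF.L_le
  have hαρ : 2 * (α * δ) ≤ ρ := by linarith
  have h := (tDv_of_letters3131R hG hF hrow hB₃ ht hBdD hαρ hαδ hρT hρ₃ hgD hdomW hlocW hdiv hR ε hε).2
  have hK : 0 ≤ (B₃ * L₀ * L₀ + BdD ε) * t * c :=
    mul_nonneg (mul_nonneg (add_nonneg (mul_nonneg (mul_nonneg hB₃ hL₀) hL₀) (hBdD ε hε)) ht) hc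
  have hδK' : δK ≤ ρ - α * δ - α * δ := by linarith
  exact h.mono fun a b => kernel_le₃ (mul_nonneg (by norm_num) hK) (hθv ε hε) hδK' (hG.dnn a b)

/-! ## §4 The whole schema `StepDir` from Theorem 3.3 for G₀ and the letters (left and right splits) -/

omit [Fintype Y] [Fintype P] in
/-- ★★ **THE WHOLE DIRECTION-INDEXED STEP SCHEMA OF ROWS 20–21 FROM THEOREM 3.3 FOR G₀ AND THE LETTERS** — `StepDir 𝔬 𝔭 Dd Dds R₀ H₀ bHX hlen θD θH δK U`
(n06-d's `hstepC`, conjunct 1) with NO operator-product hypothesis left: the eight left-form families by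
`B9Thm312WholeStepDirFrom3131.stepDir_of_letters3131`, the two right-form families by `tDd_of_letters3131R`.  Inputs: `Thm33G0Dir` + `Thm33G0DirR`
(rows 18's), `Letters313H`, `Letters313DM`, `Thm33G0DirX`, `Thm33G0DivR`, the block-sup domination of the input norms (`domX ∕ locX`, the shape of
`Letters313IM`'s fields), `Letters3131`, `Letters3131H`, `Letters3131R`, the row sum, `Facts347`; constants θ_D ≧ 2(B₀ + κ_H·B₃)tc, θ_H ≧ the three
β-families of the left form AND (LOCATED REMARK U3) θ_H ≧ 2(B₀L₀ + B_iD(ε))tc FOR ALL ε > 0; rates 0 ≦ δ_K, δ_K + αδ ≦ ρ ≦ δ_T, ρ + σ ≦ min(δ₀, δ₃).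
[cite: Balaban1985BackgroundPropagators, Thm 3.12 p.423 + (3.130)–(3.131) pp.421–422 + (3.137)–(3.138) p.423 + Thm 3.3 p.399 + (3.42)–(3.45) pp.397–398 + (3.39)–(3.40) p.397 + p.398 (remarks after (3.47)); Balaban1984PropagatorsII, (2.26) p.228 + (2.54) p.233 + Lemma 2.1 (2.60)–(2.61) p.234] -/
theorem stepDir_of_letters3131LR (hG : GeoOK g) {𝔬 : Ops g B X Y Z W} {𝔭 : HolderProbes g B X Y PX PY}
    {Dd Dds : B.Cfg → P → Module.End ℝ (X → ℝ)} {bHX : ℝ → BlockNorm (toB6 g R₀ H₀) (X → ℝ)}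
    {bHW : ℝ → BlockNorm (toB6 g R₀ H₀) (W → ℝ)} {bH : BlockNorm (toB6 g R₀ H₀) (W → ℝ)}
    {Ta Ta₂ : B.Cfg → Module.End ℝ (X → ℝ)} {Tb Tb₂ : B.Cfg → (X → ℝ) →ₗ[ℝ] (W → ℝ)}
    {Ta' Ta₂' : B.Cfg → Module.End ℝ (X → ℝ)} {Tb' Tb₂' : B.Cfg → (W → ℝ) →ₗ[ℝ] (X → ℝ)}
    {U : B.Cfg} {d : ℕ} {δ α L₀ : ℝ} (hF : Facts347 g R₀ H₀ d δ α L₀)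
    {B₀ B₃ t δ₀ δ₃ δT ρ σ c θD θH δK : ℝ} {Bh Bi : ℝ → ℝ} {Bi2 : ℝ → ℝ → ℝ} {BhD Bx Bq Bx0 BdX BiD BdD : ℝ → ℝ}
    (hrow : RowSum (toB6 g R₀ H₀) σ c) (hc : 0 ≤ c) (hB₀ : 0 ≤ B₀) (hB₃ : 0 ≤ B₃) (ht : 0 ≤ t)
    (hBh : ∀ β : ℝ, 0 ≤ β → β < 1 → 0 ≤ Bh β) (hBhD : ∀ β : ℝ, 0 ≤ β → β < 1 → 0 ≤ BhD β)
    (hBx : ∀ β : ℝ, 0 ≤ β → β < 1 → 0 ≤ Bx β) (hBx0 : ∀ β : ℝ, 0 ≤ β → β < 1 → 0 ≤ Bx0 β)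
    (hBdX : ∀ β : ℝ, 0 ≤ β → β < 1 → 0 ≤ BdX β) (hBiD : ∀ ε : ℝ, 0 < ε → 0 ≤ BiD ε)
    (hρT : ρ ≤ δT) (hρ₀ : ρ + σ ≤ δ₀) (hρ₃ : ρ + σ ≤ δ₃) (hαδ : 0 ≤ α * δ) (hδK0 : 0 ≤ δK) (hδK : δK + α * δ ≤ ρ)
    (hθD : 2 * ((B₀ + bH.κ * B₃) * t * c) ≤ θD)
    (hθH1 : ∀ β : ℝ, 0 ≤ β → β < 1 → 2 * ((Bh β + bH.κ * BhD β) * t * c) ≤ θH)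
    (hθH2 : ∀ β : ℝ, 0 ≤ β → β < 1 → 2 * ((Bh β + bH.κ * BdX β) * t * c) ≤ θH)
    (hθH3 : ∀ β : ℝ, 0 ≤ β → β < 1 → 2 * ((Bx0 β + Bx β) * t * c * L₀) ≤ θH)
    (hθH4 : ∀ ε : ℝ, 0 < ε → 2 * ((B₀ * L₀ + BiD ε) * t * c) ≤ θH)
    (h33 : Thm33G0Dir 𝔬 𝔭 Dd Dds R₀ H₀ bHX B₀ Bh Bi Bi2 δ₀ U) (h33R : Thm33G0DirR 𝔬 Dds R₀ H₀ B₀ δ₀ U)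
    (hLH3 : Letters313H 𝔬 𝔭 R₀ H₀ hG.lenle bH BhD Bx δ₃ U)
    (hDM : Letters313DM 𝔬 𝔭 Dd R₀ H₀ hG B₃ Bq δ₃ bH U) (hX : Thm33G0DirX 𝔬 𝔭 Dd R₀ H₀ hG.lenle bH Bx0 BdX δ₀ δ₃ U)
    (hdiv : Thm33G0DivR 𝔬 Dds R₀ H₀ hG.lenle bHX bHW BiD BdD δ₀ δ₃ U)
    (hdomX : ∀ ε : ℝ, 0 < ε → ∀ (y : g.Site) (μ : X → ℝ), (BlockNorm.ofBlocks (toB6 g R₀ H₀) 𝔬.blk).loc y μ ≤ (bHX ε).loc y μ)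
    (hlocX : ∀ ε : ℝ, 0 < ε → ∀ (y : g.Site) (μ : X → ℝ), (bHX ε).IsLoc y μ → (BlockNorm.ofBlocks (toB6 g R₀ H₀) 𝔬.blk).IsLoc y μ)
    (hL : Letters3131 𝔬 Ta Ta₂ Tb Tb₂ R₀ H₀ hG.lenle t δT U) (hLH : Letters3131H 𝔬 Tb Tb₂ R₀ H₀ hG.lenle bH t δT U)
    (hR : Letters3131R 𝔬 Ta' Ta₂' Tb' Tb₂' R₀ H₀ hG.lenle t δT U) :
    StepDir 𝔬 𝔭 Dd Dds R₀ H₀ bHX hG.lenle θD θH δK U := by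
  have hαρ : α * δ ≤ ρ := by linarith
  have hδKρ' : δK ≤ ρ - α * δ := by linarith
  have hL₀ : 0 ≤ L₀ := le_trans (le_trans zero_le_one hF.one_le_L) hF.L_le
  have hright := fun (μ : P) (ε : ℝ) (hε : 0 < ε) =>
    tDd_of_letters3131R hG hF hrow hB₀ ht hBiD hαρ hαδ hρT hρ₀ h33R.e2d hdomX hlocX hdiv hR μ ε hε
  have hK : ∀ ε : ℝ, 0 < ε → 0 ≤ (B₀ * L₀ + BiD ε) * t * c := fun ε hε =>
    mul_nonneg (mul_nonneg (add_nonneg (mul_nonneg hB₀ hL₀) (hBiD ε hε)) ht) hc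
  refine stepDir_of_letters3131 hG hF hrow hc hB₀ hB₃ ht hBh hBhD hBx hBx0 hBdX hρT hρ₀ hρ₃ hαδ hδK0 hδK hθD hθH1 hθH2 hθH3
    h33 hLH3 hDM hX hL hLH (fun μ ε hε => ?_) (fun μ ε hε => ?_)
  · have hc1 : (B₀ * L₀ + BiD ε) * t * c ≤ θH := by linarith [hθH4 ε hε, hK ε hε]
    exact (hright μ ε hε).1.mono fun a b => kernel_le₃ (hK ε hε) hc1 hδKρ' (hG.dnn a b)
  · exact (hright μ ε hε).2.mono fun a b => kernel_le₃ (mul_nonneg (by norm_num) (hK ε hε)) (hθH4 ε hε) hδKρ' (hG.dnn a b)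

end

end Literature.MathematicalPhysics.QuantumFieldTheory.Balaban1983to89.B9Thm312WholeRightStepFrom3131
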